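import Mathlib
import Summits.NavierStokesRegularity.NavierStokesRegularity.Theorems.ThreadingFluxHorizonTowerL2ClosedForm
import HarnessLib

/-!
# Crux `PoloidalLiouville` (stmt-NavierStokesRegularity-1222, wall W1), crux idea «horizon-threading-tower» (ns-idea-15):
# THE ORDER-TWO HORIZON LAW OF A SINGLE-DEGREE HORIZON PROFILE IN CLOSED FORM (all degrees `l`) — part 2: `curl λ`, the two
# contractions against `z`, and the law `𝔏₂[U_H] = −4(l−1)(l+2) · det(∇H, ∇|∇H|², x) / ‖x‖^{3(l−1)}`

Support file (Theorems-side tooling; seat ns-wall-eng-4 g2, cell ns-wall-extremal, item «HT1 (ii) IDENTIFICATION»;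
`--supports stmt-NavierStokesRegularity-1222 --as helper`).  Continues `ThreadingFluxHorizonTowerL2ClosedForm.lean` (p671728).
Notation as there: `H` smooth, `l`-homogeneous (`l ≥ 1`), harmonic; `U = horizonProfile l H 0`; `q = ‖z‖²`, `a = (1 − l)/2`,
`κ = (l − 1)(l + 2)`, `G = ‖∇H‖²`, `W = ∇H × z`, `V = ∇G × z`, `det(∇H, ∇G, z) = ⟪∇H, ∇G × z⟫`.  Off the origin:

* `HorizonTower.curl_lamb_horizonProfile_eq` — `curl (U × Ω) = 4κl² q^{2a−2} H W − 2κ q^{2a−1} V`;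
* `HorizonTower.lambCrossVorticity_eq`, `HorizonTower.inner_self_curl_lambCrossVorticity` — `(U×Ω)×Ω ∈ span{∇H, z}` in
  closed form and `⟪z, curl((U×Ω)×Ω)⟫ = 2κ² q^{3a−1} det(∇H, ∇G, z)`;
* `HorizonTower.profileCrossCurlLamb_eq`, `HorizonTower.inner_self_curl_profileCrossCurlLamb` — `U × curl(U×Ω) ∈ span{∇H, ∇G, z}`
  in closed form and `⟪z, curl(U × curl(U×Ω))⟫ = −2κ l(l+1) q^{3a−1} det(∇H, ∇G, z)`;
* ★ `HorizonTower.horizonL2_horizonProfile_eq_det` — **`horizonL2 (horizonProfile l H 0) 0 x = −4(l−1)(l+2) · det(∇H(x), ∇G(x), x) / ‖x‖^{3(l−1)}`**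
  for every `x ≠ 0`: the ENGINE IDENTITY E-𝔏₂ of DATUM B-ht2 (ns-wall-eng-7 g3: exact for the generic harmonic of degree `l ≤ 7`,
  pen-and-paper for all `l`) as a kernel theorem for all `l ≥ 1`, BY NAME on the tree's `horizonL2` / `horizonProfile`.

Consequence (separate file): the l = 3 IDENTIFICATION `‖x‖⁶ · horizonL2 (horizonProfile 3 (cubicHE3 a) 0) 0 x = horizonNumerator a x`
via `CubicCert.horizonNumerator_eq_det` (p670909), hence `HorizonZonalitySingleDegree` at `l = 3` unconditionally (p670358).
For general `l` the law reduces `HorizonZonalitySingleDegree l` to «a degree-`l` solid harmonic with `det(∇H, ∇|∇H|², x) ≡ 0` is zonal»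
(transnormal spherical harmonics; eng-7 g3's memo L2-IDENTITY.md §3 — not claimed here).

HONEST LABEL: pure vector calculus about the typed objects of one crux idea (information-grade for W1/W2, movement 0);
`PoloidalLiouville` (1222), `UnthreadedRigidity` (27585) and NS regularity remain OPEN and untouched.
[cite: MajdaBertozziCUP2002, §1.1 (vector identities)]
-/

-- the summit and its single problem share the name (D-0017 nested layout)
set_option linter.dupNamespace false

noncomputable section

open Set Function Filter Topology
open scoped Topology RealInnerProductSpace
open Literature.Analysis.FluidPDE

namespace Summit.NavierStokesRegularity.NavierStokesRegularity.Theorems.PoloidalLiouville.HorizonTower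

open PoloidalField OrderTwo

/-! ### Two more toolkit lemmas -/

namespace OrderTwo

/-- `∇(f + g)(x) = ∇f(x) + ∇g(x)` at a point of differentiability. [folklore] -/
theorem gradient_add' {f g : E3 → ℝ} {x : E3} (hf : DifferentiableAt ℝ f x) (hg : DifferentiableAt ℝ g x) :
    gradient (fun z => f z + g z) x = gradient f x + gradient g x := by
  apply ext_inner_right ℝ
  intro v
  rw [inner_add_left, Literature.Analysis.FluidPDE.inner_gradient_left,
    Literature.Analysis.FluidPDE.inner_gradient_left, Literature.Analysis.FluidPDE.inner_gradient_left,
    fderiv_fun_add hf hg]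
  simp

/-- `H ∈ C^∞ ⇒ ∇H ∈ C²` (the amount of regularity used below). [folklore] -/
theorem contDiff_two_gradient {θ : E3 → ℝ} (hθ : ContDiff ℝ (⊤ : ℕ∞) θ) : ContDiff ℝ 2 (gradient θ) := by
  have h3 : ContDiff ℝ 3 θ := hθ.of_le (by norm_cast)
  exact (InnerProductSpace.toDual ℝ E3).symm.contDiff.comp (h3.fderiv_right (m := 2) (by norm_num))

end OrderTwo

section CurlLamb

variable {l : ℕ} {H : E3 → ℝ}

/-- **`curl (U × Ω) = 4κl² q^{2a−2} H W − 2κ q^{2a−1} V` off the origin**, `W = ∇H × z`, `V = ∇G × z`, `G = ‖∇H‖²`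
(so `𝔏₁[U_H] = ‖z‖⟪z, curl(U×Ω)⟫ = 0`, cf. `horizonL1_horizonProfile`). [cite: MajdaBertozziCUP2002, §1.1 (vector identities)] -/
theorem curl_lamb_horizonProfile_eq (hl : 1 ≤ l) (hH : ContDiff ℝ (⊤ : ℕ∞) H)
    (hhom : ∀ (c : ℝ) (y : E3), H (c • y) = c ^ l * H y) (hharm : ∀ y, Laplacian.laplacian H y = 0)
    {z : E3} (hz : z ≠ 0) :
    curl (fun w => cross (horizonProfile l H 0 w) (curl (horizonProfile l H 0) w)) z
      = (4 * (((l : ℝ) - 1) * (l + 2)) * (l : ℝ) ^ 2 * ((‖z‖ ^ 2) ^ (2 * (((1 : ℝ) - l) / 2) - 2) * H z))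
          • cross (gradient H z) z
        + (-(2 * (((l : ℝ) - 1) * (l + 2)) * (‖z‖ ^ 2) ^ (2 * (((1 : ℝ) - l) / 2) - 1)))
          • cross (gradient (fun w : E3 => ‖gradient H w‖ ^ 2) z) z := by
  set a : ℝ := ((1 : ℝ) - l) / 2 with ha
  have hHd : ∀ w, DifferentiableAt ℝ H w := fun w => (hH.differentiable (by simp)).differentiableAt
  have hH2 : ContDiffAt ℝ 2 H z := (hH.of_le (by norm_cast)).contDiffAt
  have hGd : DifferentiableAt ℝ (fun w : E3 => ‖gradient H w‖ ^ 2) z := (differentiableAt_gradient hH2).norm_sq ℝ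
  have hopen : ∀ᶠ w in 𝓝 z, w ≠ (0 : E3) := isOpen_compl_singleton.mem_nhds hz
  have hev : (fun w => cross (horizonProfile l H 0 w) (curl (horizonProfile l H 0) w)) =ᶠ[𝓝 z] fun w =>
      ((((l : ℝ) - 1) * (l + 2)) * (l * (l + 1)) * ((‖w‖ ^ 2) ^ (2 * a - 1) * H w)) • gradient H w
        + (-(((l : ℝ) - 1) * (l + 2)) * (2 * ((‖w‖ ^ 2) ^ (2 * a - 1) * ‖gradient H w‖ ^ 2)
            + (l : ℝ) ^ 2 * (l - 1) * ((‖w‖ ^ 2) ^ (2 * a - 2) * H w ^ 2))) • w := by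
    filter_upwards [hopen] with w hw using lamb_horizonProfile_eq hl hH hhom hharm hw
  rw [curl_eq_curlCLM, hev.fderiv_eq, ← curl_eq_curlCLM]
  have hA' : DifferentiableAt ℝ (fun w : E3 => (‖w‖ ^ 2) ^ (2 * a - 1) * H w) z :=
    (differentiableAt_rpow_normSq hz _).mul (hHd z)
  have hA : DifferentiableAt ℝ (fun w : E3 => (((l : ℝ) - 1) * (l + 2)) * (l * (l + 1)) * ((‖w‖ ^ 2) ^ (2 * a - 1) * H w)) z :=
    hA'.const_mul _
  have hB1 : DifferentiableAt ℝ (fun w : E3 => (‖w‖ ^ 2) ^ (2 * a - 1) * ‖gradient H w‖ ^ 2) z :=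
    (differentiableAt_rpow_normSq hz _).mul hGd
  have hB2 : DifferentiableAt ℝ (fun w : E3 => (‖w‖ ^ 2) ^ (2 * a - 2) * H w ^ 2) z :=
    (differentiableAt_rpow_normSq hz _).mul ((hHd z).pow 2)
  have hB12 : DifferentiableAt ℝ (fun w : E3 => 2 * ((‖w‖ ^ 2) ^ (2 * a - 1) * ‖gradient H w‖ ^ 2)
      + (l : ℝ) ^ 2 * (l - 1) * ((‖w‖ ^ 2) ^ (2 * a - 2) * H w ^ 2)) z := (hB1.const_mul 2).add (hB2.const_mul _)
  have hB : DifferentiableAt ℝ (fun w : E3 => -(((l : ℝ) - 1) * (l + 2)) * (2 * ((‖w‖ ^ 2) ^ (2 * a - 1) * ‖gradient H w‖ ^ 2)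
      + (l : ℝ) ^ 2 * (l - 1) * ((‖w‖ ^ 2) ^ (2 * a - 2) * H w ^ 2))) z := hB12.const_mul _
  have h1d : DifferentiableAt ℝ (fun w : E3 =>
      ((((l : ℝ) - 1) * (l + 2)) * (l * (l + 1)) * ((‖w‖ ^ 2) ^ (2 * a - 1) * H w)) • gradient H w) z :=
    hA.smul (differentiableAt_gradient hH2)
  have h2d : DifferentiableAt ℝ (fun w : E3 =>
      (-(((l : ℝ) - 1) * (l + 2)) * (2 * ((‖w‖ ^ 2) ^ (2 * a - 1) * ‖gradient H w‖ ^ 2)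
        + (l : ℝ) ^ 2 * (l - 1) * ((‖w‖ ^ 2) ^ (2 * a - 2) * H w ^ 2))) • w) z :=
    hB.smul differentiableAt_id
  rw [curl_add h1d h2d, curl_smul_gradient hA hH2, curl_smul_self hB]
  rw [gradient_const_mul' hA', gradient_mul_apply (differentiableAt_rpow_normSq hz _) (hHd z),
    gradient_rpow_normSq hz (2 * a - 1)]
  rw [gradient_const_mul' hB12, gradient_add' (hB1.const_mul 2) (hB2.const_mul _), gradient_const_mul' hB1,
    gradient_const_mul' hB2, gradient_mul_apply (differentiableAt_rpow_normSq hz _) hGd,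
    gradient_rpow_normSq hz (2 * a - 1),
    gradient_mul_apply (g := fun w => H w ^ 2) (differentiableAt_rpow_normSq hz _) ((hHd z).pow 2),
    gradient_rpow_normSq hz (2 * a - 2), gradient_sq (hHd z)]
  rw [show (2 * a - 1 - 1 : ℝ) = 2 * a - 2 by ring]
  simp only [smul_add, smul_smul, Tao2016.cross_add_left, Tao2016.cross_smul_left, Tao2016.cross_self_eq_zero,
    smul_zero, zero_add, add_zero]
  rw [cross_swap z (gradient H z), smul_neg, ← neg_smul, ha]
  module

end CurlLamb

/-! ### First contraction: `⟪z, curl((U×Ω)×Ω)⟫` -/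

section Contractions

variable {l : ℕ} {H : E3 → ℝ}

/-- **`(U×Ω)×Ω` in closed form off the origin**: with `λ = U × Ω`,
`λ × Ω = κ²(2l² q^{3a−2} H² − 2 q^{3a−1} G) ∇H − κ² l(l−1)(q^{3a−2} H G − l² q^{3a−3} H³) z`.
[cite: MajdaBertozziCUP2002, §1.1 (vector identities)] -/
theorem lambCrossVorticity_eq (hl : 1 ≤ l) (hH : ContDiff ℝ (⊤ : ℕ∞) H)
    (hhom : ∀ (c : ℝ) (y : E3), H (c • y) = c ^ l * H y) (hharm : ∀ y, Laplacian.laplacian H y = 0)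
    {z : E3} (hz : z ≠ 0) :
    cross (cross (horizonProfile l H 0 z) (curl (horizonProfile l H 0) z)) (curl (horizonProfile l H 0) z)
      = ((((l : ℝ) - 1) * (l + 2)) ^ 2 * (2 * (l : ℝ) ^ 2 * ((‖z‖ ^ 2) ^ (3 * (((1 : ℝ) - l) / 2) - 2) * H z ^ 2)
          + (-2) * ((‖z‖ ^ 2) ^ (3 * (((1 : ℝ) - l) / 2) - 1) * ‖gradient H z‖ ^ 2))) • gradient H z
        + (-(((l : ℝ) - 1) * (l + 2)) ^ 2 * (l * (l - 1))
            * ((‖z‖ ^ 2) ^ (3 * (((1 : ℝ) - l) / 2) - 2) * H z * ‖gradient H z‖ ^ 2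
              - (l : ℝ) ^ 2 * ((‖z‖ ^ 2) ^ (3 * (((1 : ℝ) - l) / 2) - 3) * H z ^ 3))) • z := by
  rw [lamb_horizonProfile_eq hl hH hhom hharm hz, curl_horizonProfile_eq hl hH hhom hharm hz]
  set a : ℝ := ((1 : ℝ) - l) / 2 with ha
  have hq : 0 < ‖z‖ ^ 2 := by positivity
  have hHd : ∀ w, DifferentiableAt ℝ H w := fun w => (hH.differentiable (by simp)).differentiableAt
  have hE : ⟪gradient H z, z⟫ = (l : ℝ) * H z := inner_gradient_self_of_homogeneous_nat (hHd z) hhom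
  have hE' : ⟪z, gradient H z⟫ = (l : ℝ) * H z := by rw [real_inner_comm, hE]
  rw [Tao2016.cross_smul_right, Tao2016.cross_add_left, Tao2016.cross_smul_left, Tao2016.cross_smul_left,
    Tao2016.cross_cross_eq_smul_sub, Tao2016.cross_cross_eq_smul_sub, hE, hE',
    real_inner_self_eq_norm_sq, real_inner_self_eq_norm_sq]
  obtain ⟨-, h2, h3, h4, h5, h6⟩ := rpow_canon hq a
  rw [h2, h3, h4, h5, h6]
  module

/-- **First contraction: `⟪z, curl((U×Ω)×Ω)(z)⟫ = 2κ² q^{3a−1} det(∇H, ∇G, z)`** off the origin (only the `∇G`-part of the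
gradient of the `∇H`-coefficient survives against `z`). [cite: MajdaBertozziCUP2002, §1.1 (vector identities)] -/
theorem inner_self_curl_lambCrossVorticity (hl : 1 ≤ l) (hH : ContDiff ℝ (⊤ : ℕ∞) H)
    (hhom : ∀ (c : ℝ) (y : E3), H (c • y) = c ^ l * H y) (hharm : ∀ y, Laplacian.laplacian H y = 0)
    {z : E3} (hz : z ≠ 0) :
    ⟪z, curl (fun w => cross (cross (horizonProfile l H 0 w) (curl (horizonProfile l H 0) w))
        (curl (horizonProfile l H 0) w)) z⟫
      = (2 * (((l : ℝ) - 1) * (l + 2)) ^ 2 * (‖z‖ ^ 2) ^ (3 * (((1 : ℝ) - l) / 2) - 1))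
          * ⟪gradient H z, cross (gradient (fun w : E3 => ‖gradient H w‖ ^ 2) z) z⟫ := by
  set a : ℝ := ((1 : ℝ) - l) / 2 with ha
  set κ : ℝ := ((l : ℝ) - 1) * (l + 2) with hκ
  have hHd : ∀ w, DifferentiableAt ℝ H w := fun w => (hH.differentiable (by simp)).differentiableAt
  have hH2 : ContDiffAt ℝ 2 H z := (hH.of_le (by norm_cast)).contDiffAt
  have hGd : DifferentiableAt ℝ (fun w : E3 => ‖gradient H w‖ ^ 2) z := (differentiableAt_gradient hH2).norm_sq ℝ
  have hopen : ∀ᶠ w in 𝓝 z, w ≠ (0 : E3) := isOpen_compl_singleton.mem_nhds hz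
  -- the closed form near `z`
  have hev : (fun w => cross (cross (horizonProfile l H 0 w) (curl (horizonProfile l H 0) w))
      (curl (horizonProfile l H 0) w)) =ᶠ[𝓝 z] fun w =>
      (κ ^ 2 * (2 * (l : ℝ) ^ 2 * ((‖w‖ ^ 2) ^ (3 * a - 2) * H w ^ 2)
          + (-2) * ((‖w‖ ^ 2) ^ (3 * a - 1) * ‖gradient H w‖ ^ 2))) • gradient H w
        + (-κ ^ 2 * (l * (l - 1)) * ((‖w‖ ^ 2) ^ (3 * a - 2) * H w * ‖gradient H w‖ ^ 2
              - (l : ℝ) ^ 2 * ((‖w‖ ^ 2) ^ (3 * a - 3) * H w ^ 3))) • w := by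
    filter_upwards [hopen] with w hw using lambCrossVorticity_eq hl hH hhom hharm hw
  rw [curl_eq_curlCLM, hev.fderiv_eq, ← curl_eq_curlCLM]
  -- differentiability of the coefficients
  have hα1 : DifferentiableAt ℝ (fun w : E3 => (‖w‖ ^ 2) ^ (3 * a - 2) * H w ^ 2) z :=
    (differentiableAt_rpow_normSq hz _).mul ((hHd z).pow 2)
  have hα2 : DifferentiableAt ℝ (fun w : E3 => (‖w‖ ^ 2) ^ (3 * a - 1) * ‖gradient H w‖ ^ 2) z :=
    (differentiableAt_rpow_normSq hz _).mul hGd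
  have hα12 : DifferentiableAt ℝ (fun w : E3 => 2 * (l : ℝ) ^ 2 * ((‖w‖ ^ 2) ^ (3 * a - 2) * H w ^ 2)
      + (-2) * ((‖w‖ ^ 2) ^ (3 * a - 1) * ‖gradient H w‖ ^ 2)) z := (hα1.const_mul _).add (hα2.const_mul _)
  have hα : DifferentiableAt ℝ (fun w : E3 => κ ^ 2 * (2 * (l : ℝ) ^ 2 * ((‖w‖ ^ 2) ^ (3 * a - 2) * H w ^ 2)
      + (-2) * ((‖w‖ ^ 2) ^ (3 * a - 1) * ‖gradient H w‖ ^ 2))) z := hα12.const_mul _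
  have hβ : DifferentiableAt ℝ (fun w : E3 => -κ ^ 2 * (l * (l - 1)) * ((‖w‖ ^ 2) ^ (3 * a - 2) * H w * ‖gradient H w‖ ^ 2
      - (l : ℝ) ^ 2 * ((‖w‖ ^ 2) ^ (3 * a - 3) * H w ^ 3))) z :=
    ((((differentiableAt_rpow_normSq hz _).mul (hHd z)).mul hGd).sub
      (((differentiableAt_rpow_normSq hz _).mul ((hHd z).pow 3)).const_mul _)).const_mul _
  have h1d : DifferentiableAt ℝ (fun w : E3 => (κ ^ 2 * (2 * (l : ℝ) ^ 2 * ((‖w‖ ^ 2) ^ (3 * a - 2) * H w ^ 2)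
      + (-2) * ((‖w‖ ^ 2) ^ (3 * a - 1) * ‖gradient H w‖ ^ 2))) • gradient H w) z :=
    hα.smul (differentiableAt_gradient hH2)
  have h2d : DifferentiableAt ℝ (fun w : E3 => (-κ ^ 2 * (l * (l - 1)) * ((‖w‖ ^ 2) ^ (3 * a - 2) * H w * ‖gradient H w‖ ^ 2
      - (l : ℝ) ^ 2 * ((‖w‖ ^ 2) ^ (3 * a - 3) * H w ^ 3))) • w) z := hβ.smul differentiableAt_id
  rw [curl_add h1d h2d, curl_smul_gradient hα hH2, curl_smul_self hβ, inner_add_right,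
    Tao2016.inner_self_cross_right, add_zero]
  -- the gradient of the `∇H`-coefficient
  rw [gradient_const_mul' hα12, gradient_add' (hα1.const_mul _) (hα2.const_mul _), gradient_const_mul' hα1,
    gradient_const_mul' hα2, gradient_mul_apply (g := fun w => H w ^ 2) (differentiableAt_rpow_normSq hz _) ((hHd z).pow 2),
    gradient_rpow_normSq hz (3 * a - 2), gradient_sq (hHd z),
    gradient_mul_apply (differentiableAt_rpow_normSq hz _) hGd, gradient_rpow_normSq hz (3 * a - 1)]
  have hcyc : ⟪z, cross (gradient (fun w : E3 => ‖gradient H w‖ ^ 2) z) (gradient H z)⟫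
      = -⟪gradient H z, cross (gradient (fun w : E3 => ‖gradient H w‖ ^ 2) z) z⟫ := by
    rw [inner_cross_cyclic, inner_cross_cyclic, cross_swap z, inner_neg_right]
  simp only [smul_add, smul_smul, Tao2016.cross_add_left, Tao2016.cross_smul_left, Tao2016.cross_self_eq_zero,
    smul_zero, add_zero, zero_add, inner_add_right, inner_smul_right, Tao2016.inner_self_cross_left, mul_zero, hcyc]
  ring

/-! ### Second contraction: `⟪z, curl(U × curl(U×Ω))⟫` -/

/-- **`U × curl(U×Ω)` in closed form off the origin**:
`U × curl λ = 4κ l³(l+1) q^{3a−2} H² ∇H − 2κ l(l+1) q^{3a−1} H ∇G + β′ z` with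
`β′ = 4κ (q^{3a−1} ⟪∇H, ∇G⟫ + (l(l−1)² − 2l²) q^{3a−2} H G − l⁴(l−1) q^{3a−3} H³)`.
[cite: MajdaBertozziCUP2002, §1.1 (vector identities)] -/
theorem profileCrossCurlLamb_eq (hl : 1 ≤ l) (hH : ContDiff ℝ (⊤ : ℕ∞) H)
    (hhom : ∀ (c : ℝ) (y : E3), H (c • y) = c ^ l * H y) (hharm : ∀ y, Laplacian.laplacian H y = 0)
    {z : E3} (hz : z ≠ 0) :
    cross (horizonProfile l H 0 z) (curl (fun w => cross (horizonProfile l H 0 w) (curl (horizonProfile l H 0) w)) z)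
      = (4 * (((l : ℝ) - 1) * (l + 2)) * ((l : ℝ) ^ 3 * (l + 1)) * ((‖z‖ ^ 2) ^ (3 * (((1 : ℝ) - l) / 2) - 2) * H z ^ 2))
          • gradient H z
        + (-(2 * (((l : ℝ) - 1) * (l + 2)) * (l * (l + 1))) * ((‖z‖ ^ 2) ^ (3 * (((1 : ℝ) - l) / 2) - 1) * H z))
          • gradient (fun w : E3 => ‖gradient H w‖ ^ 2) z
        + (4 * (((l : ℝ) - 1) * (l + 2))
            * ((‖z‖ ^ 2) ^ (3 * (((1 : ℝ) - l) / 2) - 1) * ⟪gradient H z, gradient (fun w : E3 => ‖gradient H w‖ ^ 2) z⟫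
              + ((l : ℝ) * (l - 1) ^ 2 - 2 * l ^ 2) * ((‖z‖ ^ 2) ^ (3 * (((1 : ℝ) - l) / 2) - 2) * H z * ‖gradient H z‖ ^ 2)
              - (l : ℝ) ^ 4 * (l - 1) * ((‖z‖ ^ 2) ^ (3 * (((1 : ℝ) - l) / 2) - 3) * H z ^ 3))) • z := by
  rw [horizonProfile_eq_closedForm hl hH hhom hharm hz, curl_lamb_horizonProfile_eq hl hH hhom hharm hz]
  set a : ℝ := ((1 : ℝ) - l) / 2 with ha
  have hq : 0 < ‖z‖ ^ 2 := by positivity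
  have hHd : ∀ w, DifferentiableAt ℝ H w := fun w => (hH.differentiable (by simp)).differentiableAt
  have hH2c : ContDiff ℝ 2 H := hH.of_le (by norm_cast)
  have hE : ⟪gradient H z, z⟫ = (l : ℝ) * H z := inner_gradient_self_of_homogeneous_nat (hHd z) hhom
  have hE' : ⟪z, gradient H z⟫ = (l : ℝ) * H z := by rw [real_inner_comm, hE]
  have hEG : ⟪z, gradient (fun w : E3 => ‖gradient H w‖ ^ 2) z⟫ = (2 * ((l : ℝ) - 1)) * ‖gradient H z‖ ^ 2 := by
    rw [real_inner_comm]; exact inner_gradient_gradNormSq_self hl hH2c hhom z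
  rw [Tao2016.cross_add_right, Tao2016.cross_smul_right, Tao2016.cross_smul_right, Tao2016.cross_add_left,
    Tao2016.cross_add_left, Tao2016.cross_smul_left, Tao2016.cross_smul_left, Tao2016.cross_smul_left,
    Tao2016.cross_smul_left, Tao2016.cross_cross_eq_smul_sub, Tao2016.cross_cross_eq_smul_sub,
    Tao2016.cross_cross_eq_smul_sub, Tao2016.cross_cross_eq_smul_sub, hE, hE', hEG,
    real_inner_self_eq_norm_sq, real_inner_self_eq_norm_sq]
  obtain ⟨h1, h2, h3, h4, h5, h6⟩ := rpow_canon hq a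
  rw [h1, h2, h3, h4, h5, h6]
  module

/-- **Second contraction: `⟪z, curl(U × curl(U×Ω))(z)⟫ = −2κ l(l+1) q^{3a−1} det(∇H, ∇G, z)`** off the origin (only the
`∇H`-part of the gradient of the `∇G`-coefficient survives against `z`). [cite: MajdaBertozziCUP2002, §1.1 (vector identities)] -/
theorem inner_self_curl_profileCrossCurlLamb (hl : 1 ≤ l) (hH : ContDiff ℝ (⊤ : ℕ∞) H)
    (hhom : ∀ (c : ℝ) (y : E3), H (c • y) = c ^ l * H y) (hharm : ∀ y, Laplacian.laplacian H y = 0)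
    {z : E3} (hz : z ≠ 0) :
    ⟪z, curl (fun w => cross (horizonProfile l H 0 w)
        (curl (fun v => cross (horizonProfile l H 0 v) (curl (horizonProfile l H 0) v)) w)) z⟫
      = (-(2 * (((l : ℝ) - 1) * (l + 2)) * (l * (l + 1))) * (‖z‖ ^ 2) ^ (3 * (((1 : ℝ) - l) / 2) - 1))
          * ⟪gradient H z, cross (gradient (fun w : E3 => ‖gradient H w‖ ^ 2) z) z⟫ := by
  set a : ℝ := ((1 : ℝ) - l) / 2 with ha
  set κ : ℝ := ((l : ℝ) - 1) * (l + 2) with hκ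
  set G : E3 → ℝ := fun w : E3 => ‖gradient H w‖ ^ 2 with hG
  have hHd : ∀ w, DifferentiableAt ℝ H w := fun w => (hH.differentiable (by simp)).differentiableAt
  have hH2 : ContDiffAt ℝ 2 H z := (hH.of_le (by norm_cast)).contDiffAt
  have hG2 : ContDiffAt ℝ 2 G z := ((contDiff_two_gradient hH).norm_sq ℝ).contDiffAt
  have hGd : DifferentiableAt ℝ G z := hG2.differentiableAt (by norm_num)
  have hKd : DifferentiableAt ℝ (fun w : E3 => ⟪gradient H w, gradient G w⟫) z :=
    (differentiableAt_gradient hH2).inner ℝ (differentiableAt_gradient hG2)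
  have hopen : ∀ᶠ w in 𝓝 z, w ≠ (0 : E3) := isOpen_compl_singleton.mem_nhds hz
  have hev : (fun w => cross (horizonProfile l H 0 w)
      (curl (fun v => cross (horizonProfile l H 0 v) (curl (horizonProfile l H 0) v)) w)) =ᶠ[𝓝 z] fun w =>
      (4 * κ * ((l : ℝ) ^ 3 * (l + 1)) * ((‖w‖ ^ 2) ^ (3 * a - 2) * H w ^ 2)) • gradient H w
        + (-(2 * κ * (l * (l + 1))) * ((‖w‖ ^ 2) ^ (3 * a - 1) * H w)) • gradient G w
        + (4 * κ * ((‖w‖ ^ 2) ^ (3 * a - 1) * ⟪gradient H w, gradient G w⟫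
              + ((l : ℝ) * (l - 1) ^ 2 - 2 * l ^ 2) * ((‖w‖ ^ 2) ^ (3 * a - 2) * H w * ‖gradient H w‖ ^ 2)
              - (l : ℝ) ^ 4 * (l - 1) * ((‖w‖ ^ 2) ^ (3 * a - 3) * H w ^ 3))) • w := by
    filter_upwards [hopen] with w hw using profileCrossCurlLamb_eq hl hH hhom hharm hw
  rw [curl_eq_curlCLM, hev.fderiv_eq, ← curl_eq_curlCLM]
  have hα' : DifferentiableAt ℝ (fun w : E3 => (‖w‖ ^ 2) ^ (3 * a - 2) * H w ^ 2) z :=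
    (differentiableAt_rpow_normSq hz _).mul ((hHd z).pow 2)
  have hα : DifferentiableAt ℝ (fun w : E3 => 4 * κ * ((l : ℝ) ^ 3 * (l + 1)) * ((‖w‖ ^ 2) ^ (3 * a - 2) * H w ^ 2)) z :=
    hα'.const_mul _
  have hδ' : DifferentiableAt ℝ (fun w : E3 => (‖w‖ ^ 2) ^ (3 * a - 1) * H w) z :=
    (differentiableAt_rpow_normSq hz _).mul (hHd z)
  have hδ : DifferentiableAt ℝ (fun w : E3 => -(2 * κ * (l * (l + 1))) * ((‖w‖ ^ 2) ^ (3 * a - 1) * H w)) z :=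
    hδ'.const_mul _
  have hβ : DifferentiableAt ℝ (fun w : E3 => 4 * κ * ((‖w‖ ^ 2) ^ (3 * a - 1) * ⟪gradient H w, gradient G w⟫
      + ((l : ℝ) * (l - 1) ^ 2 - 2 * l ^ 2) * ((‖w‖ ^ 2) ^ (3 * a - 2) * H w * ‖gradient H w‖ ^ 2)
      - (l : ℝ) ^ 4 * (l - 1) * ((‖w‖ ^ 2) ^ (3 * a - 3) * H w ^ 3))) z :=
    ((((differentiableAt_rpow_normSq hz _).mul hKd).add
      ((((differentiableAt_rpow_normSq hz _).mul (hHd z)).mul hGd).const_mul _)).sub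
      (((differentiableAt_rpow_normSq hz _).mul ((hHd z).pow 3)).const_mul _)).const_mul _
  have h1d : DifferentiableAt ℝ (fun w : E3 =>
      (4 * κ * ((l : ℝ) ^ 3 * (l + 1)) * ((‖w‖ ^ 2) ^ (3 * a - 2) * H w ^ 2)) • gradient H w) z :=
    hα.smul (differentiableAt_gradient hH2)
  have h2d : DifferentiableAt ℝ (fun w : E3 =>
      (-(2 * κ * (l * (l + 1))) * ((‖w‖ ^ 2) ^ (3 * a - 1) * H w)) • gradient G w) z :=
    hδ.smul (differentiableAt_gradient hG2)
  have h12d : DifferentiableAt ℝ (fun w : E3 =>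
      (4 * κ * ((l : ℝ) ^ 3 * (l + 1)) * ((‖w‖ ^ 2) ^ (3 * a - 2) * H w ^ 2)) • gradient H w
        + (-(2 * κ * (l * (l + 1))) * ((‖w‖ ^ 2) ^ (3 * a - 1) * H w)) • gradient G w) z := h1d.add h2d
  have h3d : DifferentiableAt ℝ (fun w : E3 => (4 * κ * ((‖w‖ ^ 2) ^ (3 * a - 1) * ⟪gradient H w, gradient G w⟫
      + ((l : ℝ) * (l - 1) ^ 2 - 2 * l ^ 2) * ((‖w‖ ^ 2) ^ (3 * a - 2) * H w * ‖gradient H w‖ ^ 2)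
      - (l : ℝ) ^ 4 * (l - 1) * ((‖w‖ ^ 2) ^ (3 * a - 3) * H w ^ 3))) • w) z := hβ.smul differentiableAt_id
  rw [curl_add h12d h3d, curl_add h1d h2d, curl_smul_gradient hα hH2, curl_smul_gradient hδ hG2, curl_smul_self hβ,
    inner_add_right, inner_add_right, Tao2016.inner_self_cross_right, add_zero]
  rw [gradient_const_mul' hα', gradient_mul_apply (g := fun w => H w ^ 2) (differentiableAt_rpow_normSq hz _) ((hHd z).pow 2),
    gradient_rpow_normSq hz (3 * a - 2), gradient_sq (hHd z),
    gradient_const_mul' hδ', gradient_mul_apply (differentiableAt_rpow_normSq hz _) (hHd z), gradient_rpow_normSq hz (3 * a - 1)]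
  have hcyc : ⟪z, cross (gradient H z) (gradient G z)⟫ = ⟪gradient H z, cross (gradient G z) z⟫ := inner_cross_cyclic _ _ _
  simp only [smul_add, smul_smul, Tao2016.cross_add_left, Tao2016.cross_smul_left, Tao2016.cross_self_eq_zero,
    smul_zero, add_zero, zero_add, inner_add_right, inner_smul_right, Tao2016.inner_self_cross_left, mul_zero, hcyc]

end Contractions

/-! ### The order-two horizon law in closed form -/

section Law

variable {l : ℕ} {H : E3 → ℝ}

/-- ★ **THE ORDER-TWO HORIZON LAW OF A SINGLE-DEGREE HORIZON PROFILE (E-𝔏₂, all degrees).**  For `H : ℝ³ → ℝ` smooth,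
homogeneous of degree `l ≥ 1` and harmonic, the horizon profile `U_H = horizonProfile l H 0 = curl curl(‖y‖^{1−l} H(y) y)`
satisfies, for every `x ≠ 0`,

`horizonL2 U_H 0 x = −4 (l − 1)(l + 2) · ⟪∇H(x), ∇G(x) × x⟫ / ‖x‖^{3(l−1)}`,  `G = ‖∇H‖²`,

i.e. `𝔏₂[U_H] = −4(l−1)(l+2) r^{−3(l−1)} det(∇H, ∇|∇H|², x)` (DATUM B-ht2, ns-wall-eng-7 g3: engine-exact on the generic harmonic
for `l ≤ 7` and pen-and-paper for all `l`; here kernel-checked for all `l`).  Consequently `𝔏₂[U_H] ≡ 0` iff the Jacobian of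
`x ↦ (H, ‖∇H‖², ‖x‖²)` vanishes identically; for `l = 3` this is the IDENTIFICATION step of the by-name zonality theorem.
Vector calculus about the tower's typed objects only; `PoloidalLiouville` (1222) and NS regularity untouched.
[cite: MajdaBertozziCUP2002, §1.1 (vector identities)] -/
theorem horizonL2_horizonProfile_eq_det (hl : 1 ≤ l) (hH : ContDiff ℝ (⊤ : ℕ∞) H)
    (hhom : ∀ (c : ℝ) (y : E3), H (c • y) = c ^ l * H y) (hharm : ∀ y, Laplacian.laplacian H y = 0)
    {x : E3} (hx : x ≠ 0) :
    horizonL2 (horizonProfile l H 0) 0 x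
      = -(4 * (((l : ℝ) - 1) * (l + 2))) * ⟪gradient H x, cross (gradient (fun w : E3 => ‖gradient H w‖ ^ 2) x) x⟫
          / ‖x‖ ^ (3 * (l - 1)) := by
  unfold horizonL2
  simp only [sub_zero]
  rw [inner_add_right, inner_self_curl_lambCrossVorticity hl hH hhom hharm hx,
    inner_self_curl_profileCrossCurlLamb hl hH hhom hharm hx]
  set a : ℝ := ((1 : ℝ) - l) / 2 with ha
  have hr : 0 < ‖x‖ := norm_pos_iff.2 hx
  have hq : 0 < ‖x‖ ^ 2 := by positivity
  have hpow : ‖x‖ ^ 2 * (‖x‖ ^ 2) ^ (3 * a - 1) = (‖x‖ ^ (3 * (l - 1)))⁻¹ := by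
    rw [mul_comm, ← Real.rpow_add_one hq.ne', show (3 * a - 1 + 1 : ℝ) = 3 * a by ring,
      ← Real.rpow_natCast ‖x‖ 2, ← Real.rpow_mul hr.le, ← Real.rpow_natCast (‖x‖) (3 * (l - 1)),
      ← Real.rpow_neg hr.le]
    congr 1
    rw [ha]; push_cast [Nat.cast_sub hl]; ring
  rw [div_eq_mul_inv, ← hpow]
  ring

end Law
end Summit.NavierStokesRegularity.NavierStokesRegularity.Theorems.PoloidalLiouville.HorizonTower

end
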